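import Literature.MathematicalPhysics.QuantumLattice.LocalDynamics
import Literature.MathematicalPhysics.QuantumLattice.SpinSystemProofs
import HarnessLib

/-!
# Discharge: the local Hamiltonian `H_{Λ'}` lies in `𝔄_{Λ'}` (`localHamiltonian_isSupportedOn`)

Trunk **T-QLATTICE**, notion `local_hamiltonian_dynamics`. Sibling proof file of
`Literature/MathematicalPhysics/QuantumLattice/LocalDynamics.lean`: it discharges the named fact
(`def … : Prop`, D-0014)

* `localHamiltonian_isSupportedOn` — for a local interaction `Φ` on a finite set of sites `Λ`
  (`Φ X ∈ 𝔄_X` and `Φ X` Hermitian for every region `X`, `Interaction.IsLocal`) and every region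
  `Λ' ⊆ Λ`, the local Hamiltonian `H_{Λ'} = Σ_{X ⊆ Λ'} Φ X` (`localHamiltonian Φ Λ'`) is supported
  on `Λ'`, i.e. `H_{Λ'} ∈ 𝔄_{Λ'}` (`IsSupportedOn (localHamiltonian Φ Λ') Λ'`),

as `theorem localHamiltonian_isSupportedOn_holds : localHamiltonian_isSupportedOn`, together with
the dot-notation usable form `Interaction.IsLocal.isSupportedOn_localHamiltonian`. No statement of
`LocalDynamics` is changed; no definition and no named fact is introduced (D-0026).

## Source

* B. Nachtergaele, R. Sims, *Lieb–Robinson bounds and the exponential clustering theorem*,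
  Comm. Math. Phys. **265** (2006) 119–130, §2 (set-up, first paragraph): "An interaction for
  such a system is a map `Φ` from the set of subsets of `V` to `𝔄_V` such that `Φ(X) ∈ 𝔄_X` and
  `Φ(X) = Φ(X)^*` for all `X ⊆ V`. The Hamiltonian is defined by `H = Σ_{X ⊆ V} Φ(X)`."
  [NachtergaeleSims2006]
* O. Bratteli, D. W. Robinson, *Operator Algebras and Quantum Statistical Mechanics II* (2nd ed.,
  Springer 1997), §6.2.1: isotony `𝔄_{Λ₁} ⊆ 𝔄_{Λ₂}` for `Λ₁ ⊆ Λ₂`, and the local Hamiltonians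
  `H_Φ(Λ) = Σ_{X ⊆ Λ} Φ(X)`, eq. (6.2.4). [BratteliRobinsonII1997]

## Proof

`H_{Λ'} ∈ 𝔄_{Λ'}` is the combination of two structural properties of the local net `X ↦ 𝔄_X`:
**isotony** `𝔄_X ⊆ 𝔄_{Λ'}` for `X ⊆ Λ'` — the named fact `IsSupportedOn.mono` of `SpinSystem.lean`,
discharged as `IsSupportedOn.mono_holds` in `SpinSystemProofs.lean` — which puts every term
`Φ X ∈ 𝔄_X`, `X ∈ Λ'.powerset`, into `𝔄_{Λ'}`, and closure of `𝔄_{Λ'}` under finite sums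
(`IsSupportedOn.sum`, proved in `SpinSystem.lean`). This is the interim (pre-D-0014) proof kept as a
comment under the fact in `LocalDynamics.lean`, now fed by the discharged isotony fact.
-/

noncomputable section

open Finset

namespace Literature.MathematicalPhysics.QuantumLattice

variable {Λ : Type*} {q : ℕ} [Fintype Λ] [DecidableEq Λ]

/-- **Discharge** of `localHamiltonian_isSupportedOn`: the local Hamiltonian
`H_{Λ'} = Σ_{X ⊆ Λ'} Φ X` of a local interaction `Φ` is supported on `Λ'` (`H_{Λ'} ∈ 𝔄_{Λ'}`):
every term `Φ X ∈ 𝔄_X ⊆ 𝔄_{Λ'}` (`X ⊆ Λ'`) by isotony (`IsSupportedOn.mono_holds`), and `𝔄_{Λ'}`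
is closed under finite sums (`IsSupportedOn.sum`). Nachtergaele–Sims (2006) §2 ("`Φ(X) ∈ 𝔄_X`",
`H = Σ_{X ⊆ V} Φ(X)`); Bratteli–Robinson II §6.2.1, eq. (6.2.4) and isotony. [cite: NachtergaeleSims2006, §2] -/
theorem localHamiltonian_isSupportedOn_holds :
    localHamiltonian_isSupportedOn (Λ := Λ) (q := q) := by
  intro Φ h Λ'
  unfold localHamiltonian
  exact IsSupportedOn.sum _ fun X hX =>
    IsSupportedOn.mono_holds (h.isSupportedOn X) (mem_powerset.1 hX)

/-- Usable (dot-notation) form of `localHamiltonian_isSupportedOn_holds`: for a local interaction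
`Φ`, `H_{Λ'} = Σ_{X ⊆ Λ'} Φ X ∈ 𝔄_{Λ'}`. Nachtergaele–Sims (2006) §2; Bratteli–Robinson II §6.2.1,
eq. (6.2.4). [cite: NachtergaeleSims2006, §2] -/
theorem Interaction.IsLocal.isSupportedOn_localHamiltonian {Φ : Interaction Λ q} (h : Φ.IsLocal)
    (Λ' : Finset Λ) : IsSupportedOn (localHamiltonian Φ Λ') Λ' :=
  localHamiltonian_isSupportedOn_holds h Λ'

end Literature.MathematicalPhysics.QuantumLattice
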